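import Summits.QuantumFields.YangMills.Theorems.BalabanUVNodesN08HaarCompatibilityGuardOneStepBound
import Summits.QuantumFields.YangMills.Theorems.BalabanUVNodesN08MassesACLeastClosedFamily
import Summits.QuantumFields.YangMills.Theorems.BalabanUVNodesN08Thm2AtRecordBridgeInhabited

/-!
# BalabanUVNodes ∕ N08 — DOMINATED ONE-STEP TRANSPORTS ⇒ AN a.e. BOUND ON PRINT'S ITERATED RADON–NIKODYM HISTORY MASSES; at the slot, MODULO (H_K):
# `m_k(h,V) ≤ Π_{j<k} (1 + (K−1)s_j)^{#PBond(j+1)}` for `dU_k`-a.e. `V` — the honest (FINE-lattice-extensive) k-step consequence of part 20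

WIDTH SEAT `pub-ymgap-dag-n08-w3` g4, `W-SEAT-START-LIST.md` v10 §0 (iii); item-3 lineage part 23 = the junction of part 20 (p614907) with n08-w1 g4's weak-closure
reduction (file 17 `…N08MassesACLeastClosedFamily`, p611839), 2026-08-28.  DAG node N08 = [Balaban1985UV3] Thm 1 p. 257 + Thm 2 p. 272, (41) p. 266 (the history
masses), (5) p. 256 (the extensive shape); key item K1⁷ `StabilityBAtRecordR13SepCoPH` (stmt-QuantumFields-20542), `--supports … --as helper`.  COUNT-NEUTRAL.

WHAT THIS FILE PROVES (theorems only, 0 def; [folklore] measure theory over the two landed files; nothing of Bałaban's asserted).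
 §1 (any averaging with measurable `Ū_j`, any compact group) ★ `massRecAC_le_prod_ae_of_map_le_smul`: DOMINATED one-step transports `Ū_{j*}(dU_j) ≤ D_j·dU_{j+1}`
    (`1 ≤ D_j < ∞`, `j < k`) ⇒ print's iterated RN history masses obey **`m_k(h,V) ≤ Π_{j<k} D_j` for `dU_k`-a.e. `V`**, every history — the SCALAR family
    `ν_j = (Π_{i<j} D_i − 1)·dU_j` is weakly closed (`weakClosed_prodSmul_of_map_le_smul`), then file 17's `massRecAC_le_ae_of_weakClosed_real`.  (File 17's
    `massRecAC_le_one_ae_of_map_le` is the case `D ≡ 1`.)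
 §2 (the [B10] slot, print's averaging on `SU(N)`, every `N`) ★★ `massRecAC_avOfPrint_le_prod_ae`: MODULO (H_K) at the levels `j < k` («each guard-admitting
    one-variable fibre law of the printed exp-mean-log averaging is `≤ K·Haar`», part 20's hypothesis) and `h(δ′) = Haar{dist1 < δ′} ≠ 0`:
    **`m_k(h,V) ≤ Π_{j<k} D_j` a.e. with `D_j = h(δ′)^{−n_j}·(h(δ′) + (K−1)·h(δ_N+δ′)^{L^{d−1}−1})^{n_j}`, `n_j = #PBond(j+1)`** — part 20's one-step bound divided
    through (`le_smul_of_smul_le_smul`) and fed to §1; `haar_dist1_lt_ne_zero` (`h(δ′) > 0` for `δ′ > 0`: `dist1` is continuous and Haar charges open sets)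
    discharges the radius hypothesis (★★ `massRecAC_avOfPrint_le_prod_ae_of_pos`).

HONEST READING (numbers, not adjectives).  `log Π_{j<k} D_j = Σ_{j<k} n_j·log(1 + (K−1)s) ≤ (K−1)s·Σ_{j<k} #PBond(j+1)`, and `Σ_{j<k} #PBond(j+1) ≤ #PBond(1)·L^d∕(L^d−1)`:
the constant is extensive in the FIRST coarse lattice, NOT in `T^{(k)}` — this is the «stacking» of per-level bounds (HOME note `N08-EML-JACOBIAN.md` §4); file 15's
`hmass` wants `e^{c|T₁^{(k)}|}`, which needs the no-stacking structure and is NOT supplied here.  (H_K) is a HYPOTHESIS (engine: parts 21∕22 + n08-w6's determinant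
floor + the untyped chain rule); E6′ NOT decided; count-neutral; N08 NOT discharged; counts unmoved (typed 28∕28 · discharged 5∕27); one finite 𝕋⁴ programme at
fixed ε — R4 closes the CONDITIONAL rung `BalabanLadder.UV` only; the Yang–Mills mass gap (Clay) is NOT proved; nothing continuum ∕ OS.  0 `sorry`, standard axioms.
-/

noncomputable section

open MeasureTheory Function
open scoped ENNReal

namespace Summit.QuantumFields.YangMills.BalabanUVNodes.N08HaarCompatibilityGuardKStepMasses

open Literature.MathematicalPhysics.QuantumFieldTheory.Balaban1983to89
open Summit.QuantumFields.Balaban3D.Carriers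
open Summit.QuantumFields.Balaban3D.Proofs.MassesAC
open Summit.QuantumFields.YangMills.BalabanUVNodes.N08MassesACLeastClosedFamily (massRecAC_le_ae_of_weakClosed_real)

/-! ## §0 [folklore] Two scalar-multiple manipulations of measures -/

section Smul

variable {α : Type*} [MeasurableSpace α]

/-- `a • μ ≤ b • ν` with `0 < a < ∞` ⇒ `μ ≤ (a⁻¹·b) • ν`. [folklore] -/
theorem le_smul_of_smul_le_smul {μ ν : Measure α} {a b : ℝ≥0∞} (ha0 : a ≠ 0) (hat : a ≠ ∞) (h : a • μ ≤ b • ν) : μ ≤ (a⁻¹ * b) • ν := by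
  rw [Measure.le_iff]
  intro s hs
  have hs' := Measure.le_iff.1 h s hs
  simp only [Measure.smul_apply, smul_eq_mul] at hs' ⊢
  calc μ s = a⁻¹ * (a * μ s) := by rw [← mul_assoc, ENNReal.inv_mul_cancel ha0 hat, one_mul]
    _ ≤ a⁻¹ * (b * ν s) := mul_le_mul' le_rfl hs'
    _ = a⁻¹ * b * ν s := (mul_assoc _ _ _).symm

/-- Scalar multiplication of measures is monotone in the measure (plumbing). [folklore] -/
theorem smul_mono_left {μ ν : Measure α} (h : μ ≤ ν) (c : ℝ≥0∞) : c • μ ≤ c • ν := by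
  rw [Measure.le_iff] at h ⊢
  intro s hs
  simp only [Measure.smul_apply, smul_eq_mul]
  exact mul_le_mul' le_rfl (h s hs)

/-- `μ + (E − 1) • μ = E • μ` for `1 ≤ E`. [folklore] -/
theorem add_sub_one_smul (μ : Measure α) {E : ℝ≥0∞} (hE : 1 ≤ E) : μ + (E - 1) • μ = E • μ := by
  conv_lhs => rw [show μ + (E - 1) • μ = (1 : ℝ≥0∞) • μ + (E - 1) • μ by rw [one_smul]]
  rw [← add_smul, add_tsub_cancel_of_le hE]

/-- Products of factors `≥ 1` are `≥ 1` (plumbing). [folklore] -/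
theorem one_le_prod_range (D : ℕ → ℝ≥0∞) (hD1 : ∀ j, 1 ≤ D j) (k : ℕ) : 1 ≤ ∏ i ∈ Finset.range k, D i := by
  induction k with
  | zero => simp
  | succ k ih => rw [Finset.prod_range_succ]; exact one_le_mul ih (hD1 k)

/-- Products of finite factors are finite (plumbing). [folklore] -/
theorem prod_range_ne_top (D : ℕ → ℝ≥0∞) (hDt : ∀ j, D j ≠ ∞) (k : ℕ) : ∏ i ∈ Finset.range k, D i ≠ ∞ :=
  ENNReal.prod_ne_top fun i _ => hDt i

end Smul

/-! ## §1 Dominated one-step transports ⇒ `m_k ≤ Π_{j<k} D_j` almost everywhere -/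

section Dominated

variable {P : Params} {G : Type} [GaugeGroup G] [MeasurableSpace G] [HaarData G]
  (M₁ : ℕ) (Rcol : ℕ → ℕ) (εL εS : ℕ → ℝ) (av : ∀ j, Averaging P j G) (hav : ∀ j, AvgAC (av j).avg)

/-- **THE SCALAR FAMILY IS WEAKLY CLOSED**: `Ū_{j*}(dU_j) ≤ D_j·dU_{j+1}` (`D_j ≥ 1`) for `j < K̄` ⇒ with `E_j = Π_{i<j} D_i` the family `ν_j = (E_j − 1)·dU_j` satisfies
`(dU_j + ν_j)∘Ū_j⁻¹ ≤ dU_{j+1} + ν_{j+1}` for `j < K̄`. [cite: Balaban1985UV3, (41) p.266 + (5) p.256 (bookkeeping)] -/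
theorem weakClosed_prodSmul_of_map_le_smul (D : ℕ → ℝ≥0∞) (hD1 : ∀ j, 1 ≤ D j) (Kt : ℕ)
    (hH : ∀ j, j < Kt → (fieldMeasure P j G).map (av j).avg ≤ D j • fieldMeasure P (j + 1) G) :
    ∀ j, j < Kt → (fieldMeasure P j G + ((∏ i ∈ Finset.range j, D i) - 1) • fieldMeasure P j G).map (av j).avg ≤
      fieldMeasure P (j + 1) G + ((∏ i ∈ Finset.range (j + 1), D i) - 1) • fieldMeasure P (j + 1) G := by
  intro j hj
  rw [add_sub_one_smul _ (one_le_prod_range D hD1 j), add_sub_one_smul _ (one_le_prod_range D hD1 (j + 1)), Measure.map_smul,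
    Finset.prod_range_succ, ← smul_smul]
  exact smul_mono_left (hH j hj) _

include hav in
/-- ★ **DOMINATED ONE-STEP TRANSPORTS ⇒ `m_k(h,V) ≤ Π_{j<k} D_j` FOR `dU_k`-a.e. `V`**, every history `h`, any thresholds, any averaging with measurable `Ū_j` and the
`AvgAC` factorisation: if `Ū_{j*}(dU_j) ≤ D_j·dU_{j+1}` with `1 ≤ D_j < ∞` for `j < k`.  (`D ≡ 1` is file 17's `massRecAC_le_one_ae_of_map_le`.)
[cite: Balaban1985UV3, (41) p.266 + (5) p.256 (the extensive shape; bookkeeping)] -/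
theorem massRecAC_le_prod_ae_of_map_le_smul (D : ℕ → ℝ≥0∞) (hD1 : ∀ j, 1 ≤ D j) (hDt : ∀ j, D j ≠ ∞) (k : ℕ)
    (hH : ∀ j, j < k → (fieldMeasure P j G).map (av j).avg ≤ D j • fieldMeasure P (j + 1) G) (h : Hist P k) :
    ∀ᵐ V ∂(fieldMeasure P k G), massRecAC M₁ Rcol εL εS av k h V ≤ (∏ j ∈ Finset.range k, D j).toReal := by
  have hE1 : ∀ j, 1 ≤ ∏ i ∈ Finset.range j, D i := one_le_prod_range D hD1
  have hEt : ∀ j, ∏ i ∈ Finset.range j, D i ≠ ∞ := prod_range_ne_top D hDt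
  have hb0 : ∀ j, 0 ≤ (∏ i ∈ Finset.range j, D i).toReal - 1 := fun j => by
    have : (1 : ℝ≥0∞).toReal ≤ (∏ i ∈ Finset.range j, D i).toReal := ENNReal.toReal_mono (hEt j) (hE1 j)
    rw [ENNReal.toReal_one] at this
    linarith
  have hνb : ∀ j, j ≤ k → ((∏ i ∈ Finset.range j, D i) - 1) • fieldMeasure P j G ≤
      (fieldMeasure P j G).withDensity (fun _ => ENNReal.ofReal ((∏ i ∈ Finset.range j, D i).toReal - 1)) := by
    intro j _
    rw [withDensity_const, ENNReal.ofReal_sub _ zero_le_one, ENNReal.ofReal_toReal (hEt j), ENNReal.ofReal_one]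
  filter_upwards [massRecAC_le_ae_of_weakClosed_real M₁ Rcol εL εS av hav k (fun j => ((∏ i ∈ Finset.range j, D i) - 1) • fieldMeasure P j G)
    (weakClosed_prodSmul_of_map_le_smul av D hD1 k hH) (fun j _ => (∏ i ∈ Finset.range j, D i).toReal - 1) (fun j _ => hb0 j) hνb k le_rfl h]
    with V hV
  linarith

end Dominated

/-! ## §2 At the [B10] slot, modulo (H_K): `m_k ≤ Π_{j<k} (1 + (K−1)s)^{#PBond(j+1)}` almost everywhere -/

section Slot

open Literature.MathematicalPhysics.QuantumFieldTheory.Balaban1985CMP102.Setting (Scales)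
open Literature.MathematicalPhysics.QuantumFieldTheory.Balaban1983to89.B10RunsOfRecord (avOfPrint)
open Literature.MathematicalPhysics.QuantumFieldTheory.Balaban1983to89.ExpMeanLog (expMeanLogSU)
open Literature.MathematicalPhysics.QuantumFieldTheory.Balaban1983to89.BlockAveraging (Small avgFun)
open Literature.MathematicalPhysics.QuantumFieldTheory.Balaban1983to89.BlockAveragingHaarAC (centralBond)
open Literature.MathematicalPhysics.QuantumFieldTheory.Balaban1983to89.Node00 (SU)
open Literature.MathematicalPhysics.QuantumFieldTheory (haarProbability)
open Summit.QuantumFields.YangMills.BalabanUVNodes.N08HaarCompatibilityGuardOneStepBound (smul_map_avOfPrint_le)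
open Summit.QuantumFields.YangMills.BalabanUVNodes.N08Thm2AtRecordBridgeInhabited (avgAC_avOfPrint)

variable (N : ℕ) [NeZero N] {L : ℕ} (S : Scales L) (M₁ : ℕ) (Rcol : ℕ → ℕ) (εL εS : ℕ → ℝ)

/-- **`h(δ′) = Haar{dist1 < δ′} > 0` on `SU(N)` for `δ′ > 0`**: the set is open (`dist1 = ‖· − 1‖_{op}` is continuous) and contains `1`, and normalised Haar
measure charges nonempty open sets. [cite: Balaban1985Averaging, (19) p.21 (the letter `|· − 1|`; bookkeeping)] -/
theorem haar_dist1_lt_ne_zero {δ' : ℝ} (hδ' : 0 < δ') : (HaarData.haar : Measure (SU N)) {g : SU N | dist1 g < δ'} ≠ 0 := by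
  have hcont : Continuous (dist1 : SU N → ℝ) :=
    UnitaryModel.continuous_opDist1.comp (Literature.MathematicalPhysics.QuantumLattice.continuous_fundamentalRep (Fin N))
  have hopen : IsOpen {g : SU N | dist1 g < δ'} := isOpen_lt hcont continuous_const
  have hne : ({g : SU N | dist1 g < δ'} : Set (SU N)).Nonempty := ⟨1, by simpa [GaugeGroup.dist1_one] using hδ'⟩
  haveI : (haarProbability (SU N)).IsHaarMeasure := by
    unfold haarProbability
    infer_instance
  show haarProbability (SU N) {g : SU N | dist1 g < δ'} ≠ 0
  exact hopen.measure_ne_zero _ hne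

/-- **THE ONE-STEP DENSITY CONSTANT OF PART 20, DIVIDED THROUGH**: under (H_K) at level `j` and `h(δ′) ≠ 0`,
`(avOfPrint)_{j*}(dU_j) ≤ D_j • dU_{j+1}` with `D_j = h(δ′)^{−n}·(h(δ′) + (K−1)·h(δ_N+δ′)^{L^{d−1}−1})^{n}`, `n = #PBond(j+1)`.
[cite: Balaban1985UV3, (2) p.256; Balaban1987RG1, (0.4) p.253 (bookkeeping — the bound is NOT in print)] -/
theorem map_avOfPrint_le_smul_of_HK {j : ℕ} (hj : j + 1 ≤ S.P.m + S.P.K) {K : ℝ≥0∞} (hK1 : 1 ≤ K) (hKtop : K ≠ ∞)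
    (hK : ∀ (c : PBond S.P (j + 1)) (U : GaugeField S.P j (SU N)),
      (∃ g : SU N, Small (expMeanLogSU : LoopAverage (SU N)) (update U (centralBond c) g) c) →
        (HaarData.haar : Measure (SU N)).map (fun g => avgFun (expMeanLogSU : LoopAverage (SU N)) (update U (centralBond c) g) c) ≤
          K • (HaarData.haar : Measure (SU N)))
    {δ' : ℝ} (hh : (HaarData.haar : Measure (SU N)) {g : SU N | dist1 g < δ'} ≠ 0) :
    (fieldMeasure S.P j (SU N)).map (avOfPrint N S j).avg ≤
      (((HaarData.haar : Measure (SU N)) {g : SU N | dist1 g < δ'} ^ Fintype.card (PBond S.P (j + 1)))⁻¹ *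
          ((HaarData.haar : Measure (SU N)) {g : SU N | dist1 g < δ'} +
              (K - 1) * (HaarData.haar : Measure (SU N)) {g : SU N | dist1 g < min (1 / 3) (Real.pi / N) + δ'} ^ (S.P.L ^ (S.P.d - 1) - 1)) ^
            Fintype.card (PBond S.P (j + 1))) •
        fieldMeasure S.P (j + 1) (SU N) := by
  haveI := HaarData.isProb (G := SU N)
  exact le_smul_of_smul_le_smul (pow_ne_zero _ hh) (ENNReal.pow_ne_top (measure_ne_top _ _)) (smul_map_avOfPrint_le N S hj hK1 hKtop hK δ')

/-- ★★ **AT THE SLOT, MODULO (H_K): `m_k(h,V) ≤ Π_{j<k} D_j` FOR `dU_k`-a.e. `V`** — print's iterated Radon–Nikodym history masses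
(`MassesAC.massRecAC … (avOfPrint N S)`, every `N`, any thresholds, every history, `k ≤ m + K̄`) under (H_K) at every level `j < k` and `h(δ′) ≠ 0`, with
`D_j = h(δ′)^{−n_j}·(h(δ′) + (K−1)·h(δ_N+δ′)^{L^{d−1}−1})^{n_j}`, `n_j = #PBond(j+1)` — i.e. `m_k ≤ Π_{j<k}(1 + (K−1)s)^{n_j}`, `s = h(δ_N+δ′)^{L^{d−1}−1}∕h(δ′)`.
Extensive in the FIRST coarse lattice (stacking), NOT file 15's `e^{c|T₁^{(k)}|}`. [cite: Balaban1985UV3, (41) p.266 + (5) p.256 + (2) p.256; Balaban1987RG1, (0.4) p.253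
(bookkeeping — no bound of print is asserted)] -/
theorem massRecAC_avOfPrint_le_prod_ae {K : ℝ≥0∞} (hK1 : 1 ≤ K) (hKtop : K ≠ ∞) (k : ℕ) (hk : k ≤ S.P.m + S.P.K)
    (hK : ∀ j, j < k → ∀ (c : PBond S.P (j + 1)) (U : GaugeField S.P j (SU N)),
      (∃ g : SU N, Small (expMeanLogSU : LoopAverage (SU N)) (update U (centralBond c) g) c) →
        (HaarData.haar : Measure (SU N)).map (fun g => avgFun (expMeanLogSU : LoopAverage (SU N)) (update U (centralBond c) g) c) ≤
          K • (HaarData.haar : Measure (SU N)))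
    {δ' : ℝ} (hh : (HaarData.haar : Measure (SU N)) {g : SU N | dist1 g < δ'} ≠ 0) (h : Hist S.P k) :
    ∀ᵐ V ∂(fieldMeasure S.P k (SU N)), massRecAC M₁ Rcol εL εS (avOfPrint N S) k h V ≤
      (∏ j ∈ Finset.range k,
        (((HaarData.haar : Measure (SU N)) {g : SU N | dist1 g < δ'} ^ Fintype.card (PBond S.P (j + 1)))⁻¹ *
          ((HaarData.haar : Measure (SU N)) {g : SU N | dist1 g < δ'} +
              (K - 1) * (HaarData.haar : Measure (SU N)) {g : SU N | dist1 g < min (1 / 3) (Real.pi / N) + δ'} ^ (S.P.L ^ (S.P.d - 1) - 1)) ^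
            Fintype.card (PBond S.P (j + 1)))).toReal := by
  haveI := HaarData.isProb (G := SU N)
  set hδ := (HaarData.haar : Measure (SU N)) {g : SU N | dist1 g < δ'} with hhδ
  set h₂ := (HaarData.haar : Measure (SU N)) {g : SU N | dist1 g < min (1 / 3) (Real.pi / N) + δ'} with hh₂
  have hδt : hδ ≠ ∞ := measure_ne_top _ _
  have h₂t : h₂ ≠ ∞ := measure_ne_top _ _
  refine massRecAC_le_prod_ae_of_map_le_smul M₁ Rcol εL εS (avOfPrint N S) (avgAC_avOfPrint N L S)
    (fun j => (hδ ^ Fintype.card (PBond S.P (j + 1)))⁻¹ * (hδ + (K - 1) * h₂ ^ (S.P.L ^ (S.P.d - 1) - 1)) ^ Fintype.card (PBond S.P (j + 1)))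
    (fun j => ?_) (fun j => ?_) k (fun j hj => map_avOfPrint_le_smul_of_HK N S (by omega) hK1 hKtop (hK j hj) hh) h
  · -- `1 ≤ D_j`
    have hn0 : hδ ^ Fintype.card (PBond S.P (j + 1)) ≠ 0 := pow_ne_zero _ hh
    have hnt : hδ ^ Fintype.card (PBond S.P (j + 1)) ≠ ∞ := ENNReal.pow_ne_top hδt
    calc (1 : ℝ≥0∞) = (hδ ^ Fintype.card (PBond S.P (j + 1)))⁻¹ * hδ ^ Fintype.card (PBond S.P (j + 1)) := (ENNReal.inv_mul_cancel hn0 hnt).symm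
      _ ≤ (hδ ^ Fintype.card (PBond S.P (j + 1)))⁻¹ * (hδ + (K - 1) * h₂ ^ (S.P.L ^ (S.P.d - 1) - 1)) ^ Fintype.card (PBond S.P (j + 1)) :=
          mul_le_mul' le_rfl (pow_le_pow_left' le_self_add _)
  · -- `D_j < ∞`
    refine ENNReal.mul_ne_top (ENNReal.inv_ne_top.2 (pow_ne_zero _ hh)) (ENNReal.pow_ne_top ?_)
    exact ENNReal.add_ne_top.2 ⟨hδt, ENNReal.mul_ne_top (ENNReal.sub_ne_top hKtop) (ENNReal.pow_ne_top h₂t)⟩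

/-- ★★ **THE SAME WITH THE RADIUS HYPOTHESIS DISCHARGED** (`δ′ > 0` ⟹ `h(δ′) ≠ 0`, `haar_dist1_lt_ne_zero`): MODULO (H_K) at the levels `j < k`,
`m_k(h,V) ≤ Π_{j<k} D_j` for `dU_k`-a.e. `V`, every `δ′ > 0`. [cite: Balaban1985UV3, (41) p.266 + (5) p.256; Balaban1987RG1, (0.4) p.253 (bookkeeping — no bound
of print is asserted)] -/
theorem massRecAC_avOfPrint_le_prod_ae_of_pos {K : ℝ≥0∞} (hK1 : 1 ≤ K) (hKtop : K ≠ ∞) (k : ℕ) (hk : k ≤ S.P.m + S.P.K)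
    (hK : ∀ j, j < k → ∀ (c : PBond S.P (j + 1)) (U : GaugeField S.P j (SU N)),
      (∃ g : SU N, Small (expMeanLogSU : LoopAverage (SU N)) (update U (centralBond c) g) c) →
        (HaarData.haar : Measure (SU N)).map (fun g => avgFun (expMeanLogSU : LoopAverage (SU N)) (update U (centralBond c) g) c) ≤
          K • (HaarData.haar : Measure (SU N)))
    {δ' : ℝ} (hδ' : 0 < δ') (h : Hist S.P k) :
    ∀ᵐ V ∂(fieldMeasure S.P k (SU N)), massRecAC M₁ Rcol εL εS (avOfPrint N S) k h V ≤
      (∏ j ∈ Finset.range k,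
        (((HaarData.haar : Measure (SU N)) {g : SU N | dist1 g < δ'} ^ Fintype.card (PBond S.P (j + 1)))⁻¹ *
          ((HaarData.haar : Measure (SU N)) {g : SU N | dist1 g < δ'} +
              (K - 1) * (HaarData.haar : Measure (SU N)) {g : SU N | dist1 g < min (1 / 3) (Real.pi / N) + δ'} ^ (S.P.L ^ (S.P.d - 1) - 1)) ^
            Fintype.card (PBond S.P (j + 1)))).toReal :=
  massRecAC_avOfPrint_le_prod_ae N S M₁ Rcol εL εS hK1 hKtop k hk hK (haar_dist1_lt_ne_zero N hδ') h

end Slot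

end Summit.QuantumFields.YangMills.BalabanUVNodes.N08HaarCompatibilityGuardKStepMasses

end
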